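import Mathlib
import HarnessLib

/-!
# Square-integral comparison for an antitone function dominated through its primitive

Analysis/Calculus support file (everything proved, no definitions, no named facts).

Let `h : ℝ → ℝ` be antitone and bounded with `∫₀¹ h = 0`, so that its primitive `H a = ∫₀ᵃ h` is
concave on `[0, 1]` with `H 0 = H 1 = 0`. If `F` is continuous on `[0, 1]`, vanishes at `0` and
`1`, has a derivative `F'` on `(0, 1)` with `F'²` integrable, and dominates the primitive,
`H ≤ F` on `[0, 1]`, then

  `∫₀¹ h² ≤ ∫₀¹ F'²`

(`sq_integral_le_of_antitone_of_integral_le`). This is the real-variable step in the proof of the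
sharp `L²` bound for `∇ₓK/K` of R. Bamler (2020a, Prop. 4.2, case `p = 2`, §4.3), where `h` is the
decreasing rearrangement of `∂ᵥK/K` and `F = Φ' ∘ Φ⁻¹`; Bamler integrates by parts twice.

The proof given here avoids second derivatives and Stieltjes measures: with `g = F' − h` one has
pointwise `h² + 2hg ≤ F'²`, so it suffices that `∫₀¹ h g ≥ 0`. The partial integrals
`G s = ∫₀ˢ g = F s − H s` are `≥ 0` with `G 1 = 0`, and `∫ h g ≥ 0` follows from a continuous Abel
summation (`setIntegral_mul_nonneg_of_antitone`): writing `h + C = ∫ 1_{t < h} dt` (layer cake) and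
using Fubini (`setIntegral_add_mul_eq_integral_setIntegral_superlevel`), `∫ (h + C) g` is an
integral over levels `t` of `∫_{{t < h} ∩ (0,1]} g`, and each superlevel set `{t < h} ∩ (0, 1]` of
the antitone `h` is a.e. an initial interval `(0, s]` (`exists_setOf_lt_inter_Ioc_ae_eq_Ioc`), on
which the integral is `G s ≥ 0`.

What is NOT here: the rearrangement producing `h`, the function `Φ` and `∫₀¹ F'² = 1/2`, and any
heat-kernel statement.

## References

* R. H. Bamler, *Entropy and heat kernel bounds on a Ricci flow background*, arXiv:2008.07093
  (2020), §4.3, proof of Prop. 4.2. [Bamler2020Entropy]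

Folklore.
-/

noncomputable section

namespace Literature.Analysis.Calculus

open Set _root_.MeasureTheory

/-- For an antitone `h : ℝ → ℝ` and a level `t`, the part of the superlevel set `{t < h}` inside
`(0, 1]` is, up to a Lebesgue-null set, an initial interval `(0, s]` with `s ∈ [0, 1]`.
[folklore] -/
theorem exists_setOf_lt_inter_Ioc_ae_eq_Ioc {h : ℝ → ℝ} (hh : Antitone h) (t : ℝ) :
    ∃ s ∈ Icc (0 : ℝ) 1, ({a | t < h a} ∩ Ioc 0 1 : Set ℝ) =ᵐ[volume] Ioc 0 s := by
  set S : Set ℝ := insert 0 ({a | t < h a} ∩ Icc 0 1)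
  have hSne : S.Nonempty := ⟨0, mem_insert _ _⟩
  have hS1 : ∀ x ∈ S, x ≤ 1 := by
    rintro x (rfl | ⟨-, hx⟩)
    · exact zero_le_one
    · exact hx.2
  have hSbdd : BddAbove S := ⟨1, hS1⟩
  have hsub₁ : Ioo 0 (sSup S) ⊆ {a | t < h a} ∩ Ioc 0 1 := by
    intro a ha
    obtain ⟨y, hyS, hay⟩ := exists_lt_of_lt_csSup hSne ha.2
    rcases hyS with rfl | ⟨hy, hy'⟩
    · exact absurd (ha.1.trans hay) (lt_irrefl _)
    · exact ⟨lt_of_lt_of_le hy (hh hay.le), ha.1, hay.le.trans hy'.2⟩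
  have hsub₂ : {a | t < h a} ∩ Ioc 0 1 ⊆ Ioc 0 (sSup S) := fun a ha =>
    ⟨ha.2.1, le_csSup hSbdd (mem_insert_of_mem _ ⟨ha.1, Ioc_subset_Icc_self ha.2⟩)⟩
  refine ⟨sSup S, ⟨le_csSup hSbdd (mem_insert _ _), csSup_le hSne hS1⟩, ?_⟩
  refine ae_eq_set.2 ⟨?_, ?_⟩
  · rw [Set.sdiff_eq_empty.2 hsub₂, measure_empty]
  · refine measure_mono_null (fun x hx => ?_) (measure_singleton (sSup S))
    rw [mem_singleton_iff]
    by_contra hxs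
    exact hx.2 (hsub₁ ⟨hx.1.1, lt_of_le_of_ne hx.1.2 hxs⟩)

/-- Layer-cake and Fubini: for measurable `h` with `|h| ≤ C` and `g` integrable on `(0, 1]`,
`∫_{(0,1]} (h + C) g = ∫_{t ∈ [-C, C]} ∫_{{t < h} ∩ (0,1]} g`. [folklore] -/
theorem setIntegral_add_mul_eq_integral_setIntegral_superlevel {h g : ℝ → ℝ} {C : ℝ}
    (hmeas : Measurable h) (hC : ∀ a, |h a| ≤ C) (hgi : IntegrableOn g (Ioc (0 : ℝ) 1)) :
    ∫ a in Ioc (0 : ℝ) 1, (h a + C) * g a =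
      ∫ t in Icc (-C) C, ∫ a in {a | t < h a} ∩ Ioc 0 1, g a := by
  have hC0 : ∀ a, -C ≤ h a ∧ h a ≤ C := fun a => abs_le.1 (hC a)
  have hEm : MeasurableSet {p : ℝ × ℝ | p.2 < h p.1} :=
    measurableSet_lt measurable_snd (hmeas.comp measurable_fst)
  set Φ : ℝ × ℝ → ℝ := {p : ℝ × ℝ | p.2 < h p.1}.indicator fun p => g p.1
  have hΦi : Integrable Φ
      ((volume.restrict (Ioc (0 : ℝ) 1)).prod (volume.restrict (Icc (-C) C))) :=
    (hgi.integrable.comp_fst _).indicator hEm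
  have h1 : ∀ a, ∫ t in Icc (-C) C, Φ (a, t) = (h a + C) * g a := fun a => by
    have hfun : (fun t => Φ (a, t)) = (Iio (h a)).indicator fun _ => g a := rfl
    rw [hfun, integral_indicator_const _ measurableSet_Iio, smul_eq_mul,
      measureReal_restrict_apply measurableSet_Iio]
    have hI : Iio (h a) ∩ Icc (-C) C = Ico (-C) (h a) := by
      ext t
      simp only [mem_inter_iff, mem_Iio, mem_Icc, mem_Ico]
      constructor
      · rintro ⟨h1, h2, -⟩
        exact ⟨h2, h1⟩
      · rintro ⟨h1, h2⟩
        exact ⟨h2, h1, h2.le.trans (hC0 a).2⟩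
    rw [hI, Real.volume_real_Ico_of_le (by linarith [(hC0 a).1])]
    ring
  have h2 : ∀ t, ∫ a in Ioc (0 : ℝ) 1, Φ (a, t) = ∫ a in {a | t < h a} ∩ Ioc 0 1, g a :=
      fun t => by
    have hAm : MeasurableSet {a | t < h a} := hmeas measurableSet_Ioi
    have hfun : (fun a => Φ (a, t)) = {a | t < h a}.indicator g := rfl
    rw [hfun, integral_indicator hAm, Measure.restrict_restrict hAm]
  calc ∫ a in Ioc (0 : ℝ) 1, (h a + C) * g a
      = ∫ a in Ioc (0 : ℝ) 1, ∫ t in Icc (-C) C, Φ (a, t) := by simp_rw [h1]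
    _ = ∫ t in Icc (-C) C, ∫ a in Ioc (0 : ℝ) 1, Φ (a, t) := by
        rw [← integral_prod Φ hΦi, integral_prod_symm Φ hΦi]
    _ = ∫ t in Icc (-C) C, ∫ a in {a | t < h a} ∩ Ioc 0 1, g a := by simp_rw [h2]

/-- **Continuous Abel summation.** If `g` is integrable on `(0, 1]` with `∫_{(0,1]} g = 0` and
nonnegative partial integrals `∫_{(0,s]} g ≥ 0` (`s ∈ [0, 1]`), then `∫_{(0,1]} h g ≥ 0` for every
bounded antitone `h`. [folklore] -/
theorem setIntegral_mul_nonneg_of_antitone {h g : ℝ → ℝ} (hh : Antitone h)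
    (hbdd : ∃ C : ℝ, ∀ a, |h a| ≤ C) (hgi : IntegrableOn g (Ioc (0 : ℝ) 1))
    (hg0 : ∫ a in Ioc (0 : ℝ) 1, g a = 0)
    (hG : ∀ s ∈ Icc (0 : ℝ) 1, 0 ≤ ∫ a in Ioc (0 : ℝ) s, g a) :
    0 ≤ ∫ a in Ioc (0 : ℝ) 1, h a * g a := by
  obtain ⟨C, hC⟩ := hbdd
  have hmeas : Measurable h := hh.measurable
  have hhg : IntegrableOn (fun a => h a * g a) (Ioc (0 : ℝ) 1) :=
    Integrable.bdd_mul hgi hmeas.aestronglyMeasurable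
      (ae_of_all _ fun a => by rw [Real.norm_eq_abs]; exact hC a)
  have hsplit : ∫ a in Ioc (0 : ℝ) 1, h a * g a = ∫ a in Ioc (0 : ℝ) 1, (h a + C) * g a := by
    have : ∀ a, (h a + C) * g a = h a * g a + C * g a := fun a => by ring
    simp_rw [this]
    rw [integral_add hhg (Integrable.const_mul hgi C), integral_const_mul, hg0, mul_zero,
      add_zero]
  rw [hsplit, setIntegral_add_mul_eq_integral_setIntegral_superlevel hmeas hC hgi]
  refine setIntegral_nonneg measurableSet_Icc fun t _ => ?_
  obtain ⟨s, hs, hae⟩ := exists_setOf_lt_inter_Ioc_ae_eq_Ioc hh t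
  rw [setIntegral_congr_set hae]
  exact hG s hs

/-- `∫_{(0,s]} (F' − h) = F s − ∫₀ˢ h` for `s ∈ [0, 1]`, when `F` is continuous on `[0, 1]` with
`F 0 = 0` and derivative `F'` on `(0, 1)`, and `F'`, `h` are integrable on `(0, 1]` (fundamental
theorem of calculus). [folklore] -/
theorem setIntegral_Ioc_deriv_sub_eq {F F' h : ℝ → ℝ} (hF : ContinuousOn F (Icc 0 1))
    (hF0 : F 0 = 0) (hder : ∀ a ∈ Ioo (0 : ℝ) 1, HasDerivAt F (F' a) a)
    (hF'i : IntegrableOn F' (Ioc (0 : ℝ) 1)) (hhi : IntegrableOn h (Ioc (0 : ℝ) 1)) {s : ℝ}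
    (hs : s ∈ Icc (0 : ℝ) 1) :
    ∫ a in Ioc 0 s, (F' a - h a) = F s - ∫ a in (0 : ℝ)..s, h a := by
  have hF's : IntervalIntegrable F' volume 0 s :=
    (intervalIntegrable_iff_integrableOn_Ioc_of_le hs.1).2
      (hF'i.mono_set (Ioc_subset_Ioc_right hs.2))
  have hhs : IntervalIntegrable h volume 0 s :=
    (intervalIntegrable_iff_integrableOn_Ioc_of_le hs.1).2
      (hhi.mono_set (Ioc_subset_Ioc_right hs.2))
  rw [← intervalIntegral.integral_of_le hs.1, intervalIntegral.integral_sub hF's hhs,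
    intervalIntegral.integral_eq_sub_of_hasDerivAt_of_le hs.1
      (hF.mono (Icc_subset_Icc_right hs.2)) (fun x hx => hder x ⟨hx.1, hx.2.trans_le hs.2⟩)
      hF's, hF0, sub_zero]

/-- **Square-integral comparison** (the rearrangement step of Bamler 2020a, Prop. 4.2, `p = 2`).
Let `h` be antitone and bounded with `∫₀¹ h = 0`, and let `F` be continuous on `[0, 1]` with
`F 0 = F 1 = 0`, differentiable on `(0, 1)` with derivative `F'`, `F'²` integrable on `[0, 1]`.
If `∫₀ᵃ h ≤ F a` for all `a ∈ [0, 1]`, then `∫₀¹ h² ≤ ∫₀¹ F'²`.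

Proof: with `g = F' − h`, pointwise `h² + 2hg = F'² − g² ≤ F'²`, and `∫₀¹ h g ≥ 0` by
`setIntegral_mul_nonneg_of_antitone`, since `∫₀ˢ g = F s − ∫₀ˢ h ≥ 0` and `∫₀¹ g = 0`.
[cite: Bamler2020Entropy, §4.3, proof of Prop. 4.2] -/
theorem sq_integral_le_of_antitone_of_integral_le :
    ∀ (F F' h : ℝ → ℝ), ContinuousOn F (Icc 0 1) → F 0 = 0 → F 1 = 0 →
      (∀ a ∈ Ioo (0 : ℝ) 1, HasDerivAt F (F' a) a) →
      IntervalIntegrable (fun a ↦ F' a ^ 2) volume 0 1 → Antitone h →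
      (∃ C : ℝ, ∀ a, |h a| ≤ C) → ∫ a in (0 : ℝ)..1, h a = 0 →
      (∀ a ∈ Icc (0 : ℝ) 1, ∫ x in (0 : ℝ)..a, h x ≤ F a) →
      ∫ a in (0 : ℝ)..1, h a ^ 2 ≤ ∫ a in (0 : ℝ)..1, F' a ^ 2 := by
  intro F F' h hF hF0 hF1 hder hF'sq hh hbdd hint hle
  obtain ⟨C, hC⟩ := hbdd
  have hmeas : Measurable h := hh.measurable
  have hbd : ∀ᵐ a ∂(volume.restrict (Ioc (0 : ℝ) 1)), ‖h a‖ ≤ C :=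
    ae_of_all _ fun a => by rw [Real.norm_eq_abs]; exact hC a
  have hhi : IntegrableOn h (Ioc (0 : ℝ) 1) :=
    Integrable.mono' (integrable_const C) hmeas.aestronglyMeasurable hbd
  -- `F'` is a.e. equal to the measurable `deriv F` on `(0, 1)`, and square integrable there
  have hF'm : AEStronglyMeasurable F' (volume.restrict (Ioc (0 : ℝ) 1)) := by
    have hre : volume.restrict (Ioc (0 : ℝ) 1) = volume.restrict (Ioo (0 : ℝ) 1) :=
      Measure.restrict_congr_set Ioo_ae_eq_Ioc.symm
    rw [hre]
    refine (measurable_deriv F).aestronglyMeasurable.congr ?_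
    filter_upwards [ae_restrict_mem measurableSet_Ioo] with a ha
    exact (hder a ha).deriv
  have hF'i : IntegrableOn F' (Ioc (0 : ℝ) 1) :=
    ((memLp_two_iff_integrable_sq hF'm).2 hF'sq.1).integrable one_le_two
  have hgi : IntegrableOn (fun a => F' a - h a) (Ioc (0 : ℝ) 1) := hF'i.sub hhi
  have hhg : IntegrableOn (fun a => h a * (F' a - h a)) (Ioc (0 : ℝ) 1) :=
    Integrable.bdd_mul hgi hmeas.aestronglyMeasurable hbd
  have hh2 : IntegrableOn (fun a => h a ^ 2) (Ioc (0 : ℝ) 1) := by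
    have := Integrable.bdd_mul hhi hmeas.aestronglyMeasurable hbd
    rw [IntegrableOn]
    simpa only [sq] using this
  -- partial integrals of `g = F' - h` are `≥ 0`, the total integral vanishes
  have hG : ∀ s ∈ Icc (0 : ℝ) 1, 0 ≤ ∫ a in Ioc (0 : ℝ) s, (F' a - h a) := fun s hs => by
    rw [setIntegral_Ioc_deriv_sub_eq hF hF0 hder hF'i hhi hs]
    exact sub_nonneg.2 (hle s hs)
  have hg0 : ∫ a in Ioc (0 : ℝ) 1, (F' a - h a) = 0 := by
    rw [setIntegral_Ioc_deriv_sub_eq hF hF0 hder hF'i hhi ⟨zero_le_one, le_rfl⟩, hF1, hint,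
      sub_zero]
  have hkey : 0 ≤ ∫ a in Ioc (0 : ℝ) 1, h a * (F' a - h a) :=
    setIntegral_mul_nonneg_of_antitone hh ⟨C, hC⟩ hgi hg0 hG
  rw [intervalIntegral.integral_of_le zero_le_one, intervalIntegral.integral_of_le zero_le_one]
  calc ∫ a in Ioc (0 : ℝ) 1, h a ^ 2
      ≤ ∫ a in Ioc (0 : ℝ) 1, (h a ^ 2 + 2 * (h a * (F' a - h a))) := by
        rw [integral_add hh2 (Integrable.const_mul hhg 2), integral_const_mul]
        linarith
    _ ≤ ∫ a in Ioc (0 : ℝ) 1, F' a ^ 2 :=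
        integral_mono (Integrable.fun_add hh2 (Integrable.const_mul hhg 2)) hF'sq.1 fun a => by
          nlinarith [sq_nonneg (F' a - h a)]

end Literature.Analysis.Calculus
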